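import Summits.ResolutionOfSingularities.ResolutionOfSingularities.Theorems.WeightedInvariantLocalWeightedDropNCGameToricEnd
import Summits.ResolutionOfSingularities.ResolutionOfSingularities.Theorems.WeightedInvariantLocalWeightedDropSpaceCountGameInvariance

/-!
# `LocalWeightedDrop`, line `nc-game-transport`, TOT rung R6: GLUE — the rung modulo `ToricStep` only, its coordinate-free form, and the
# weighted-game consequence

[OURS · L1 W4.3 · chain w43, engine crux `LocalWeightedDrop` stmt-ResolutionOfSingularities-8899; strategist res-L1-w43-strat-1's line
`nc-game-transport`, rung R6 (`…NCToricRung` p518559: `TOTRungNonDegenerate`, `TOTRungNonDegenerateFree`, `totRungNonDegenerate_of_toric`);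
res-type-088 after (c) `toricEnd` (p521013).]  Nothing here is a statement of any manuscript; closes nothing by name.  The by-name closer
`totRungNonDegenerate m` itself is the one-liner over (b) `toricStep` (res-D-pv-006) and is NOT filed here.

* `totRungNonDegenerate_of_toricStep` — with (c) in the tree, R6 is EXACTLY (b): `ToricStep m → TOTRungNonDegenerate m`.
* `totRungNonDegenerateFree_of` — the coordinate-free form follows from the coordinate form (invariance of `WinsIn GermIsNC` under legal
  coordinate changes, `TameFourTupleDrop.winsIn_germIsNC_of_subst`).
* `won_of_dvd_pow_of_totRungNonDegenerate` — through the transport `NCTransport.won_of_winsIn` (p507842): under `TOTRungNonDegenerate m`, every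
  divisor of a power of a non-zero Newton non-degenerate germ is won in the weighted game `CobordantGame.Won k (m + 1)`.
-/

set_option linter.dupNamespace false -- mandated namespace of this single-conjunct summit

namespace Summit.ResolutionOfSingularities.ResolutionOfSingularities.Theorems

namespace NCTransport

open MvPowerSeries Literature.AlgebraicGeometry.Resolution TameFourTupleDrop

/-- **R6 MODULO (b) ONLY**: with `toricEnd` in the tree, `ToricStep m → TOTRungNonDegenerate m`. [OURS · L1 W4.3] -/
theorem totRungNonDegenerate_of_toricStep (m : ℕ) (hstep : ToricStep m) : TOTRungNonDegenerate m :=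
  totRungNonDegenerate_of_toric m hstep (toricEnd m)

/-- **THE COORDINATE-FREE FORM FOLLOWS FROM THE COORDINATE FORM**: Newton non-degeneracy after SOME legal formal coordinate change suffices
(`WinsIn GermIsNC` is invariant under legal coordinate changes). [OURS · L1 W4.3] -/
theorem totRungNonDegenerateFree_of (m : ℕ) (h : TOTRungNonDegenerate m) : TOTRungNonDegenerateFree m := by
  intro p hp k _ _ _ b hb hΦ
  obtain ⟨Φ, hΦ0, hdet, hND⟩ := hΦ
  have hb' : subst Φ b ≠ 0 := FormalCoordChange.subst_ne_zero_of_isUnit_det hΦ0 hdet hb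
  obtain ⟨n, hn⟩ := h p hp k (subst Φ b) hb' hND
  exact ⟨n, winsIn_germIsNC_of_subst hΦ0 hdet n b hn⟩

/-- Hence the coordinate-free rung modulo (b) only. -/
theorem totRungNonDegenerateFree_of_toricStep (m : ℕ) (hstep : ToricStep m) : TOTRungNonDegenerateFree m :=
  totRungNonDegenerateFree_of m (totRungNonDegenerate_of_toricStep m hstep)

/-- **R6 IN THE WEIGHTED GAME** (through `won_of_winsIn`): under `TOTRungNonDegenerate m`, over an algebraically closed field of characteristic
`p`, every divisor of a power of a non-zero Newton non-degenerate germ in `m + 1` variables is won in `CobordantGame.Won k (m + 1)`. -/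
theorem won_of_dvd_pow_of_totRungNonDegenerate {m : ℕ} (h : TOTRungNonDegenerate m) (p : ℕ) (hp : p.Prime) (k : Type) [Field k]
    [CharP k p] [IsAlgClosed k] (b : MvPowerSeries (Fin (m + 1)) k) (hb : b ≠ 0) (hND : NewtonNonDegenerate b) (N : ℕ)
    (f : MvPowerSeries (Fin (m + 1)) k) (hf : f ∣ b ^ (N + 1)) : CobordantGame.Won k (m + 1) f := by
  obtain ⟨n, hn⟩ := h p hp k b hb hND
  exact won_of_winsIn p hp n b hb hn N f hf

/-- … in particular the germ itself. -/
theorem won_of_totRungNonDegenerate {m : ℕ} (h : TOTRungNonDegenerate m) (p : ℕ) (hp : p.Prime) (k : Type) [Field k]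
    [CharP k p] [IsAlgClosed k] (b : MvPowerSeries (Fin (m + 1)) k) (hb : b ≠ 0) (hND : NewtonNonDegenerate b) :
    CobordantGame.Won k (m + 1) b :=
  won_of_dvd_pow_of_totRungNonDegenerate h p hp k b hb hND 0 b (by rw [zero_add, pow_one])

end NCTransport

end Summit.ResolutionOfSingularities.ResolutionOfSingularities.Theorems
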